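import Literature.IUT.HodgeArakelov.AbsTopMonoidsGenuineIsometries
import HarnessLib

/-!
# [IUTchII] Example 1.8 (iv): `Ism(−)` is preserved by arbitrary isomorphisms `G₁ ⥲ G₂` (proof-only, generic)

S. Mochizuki, *Inter-universal Teichmüller theory II*, §1, Example 1.8 (iv), kurims manuscript (Dec. 2020) p. 39
[claim: Mochizuki2012, status: disputed] (IUTchII §1 Ex 1.8 (iv), kurims p.39): "Let `Γ^{×μ} ⊆ Ism(−)` be a closed
subgroup, i.e., a collection of closed subgroups of each `Ism(G)` that is preserved by arbitrary isomorphisms of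
topological groups `G₁ ⥲ G₂`. … one example of such a `Γ^{×μ}` … is the case where one takes `Γ^{×μ}` to be the entire
group `Ism(−)`".  abc-iut cell, layer L6, MERGE-MAP row B9 (d) (Ism side); seat abc-iut-L6-d2 (gen 5).  PROOF-ONLY,
generic over ANY interface inhabitant `A : AbsTopMonoids S` (abc-iut-L6-t1's [AbsTopIII]-output interface) with
print's `Ism(G) := AbsTopMonoids.ism A G` (`AbsTopMonoidsGenuineIsometries.lean`, p427597; abc-iut-L6-t2's
`isometryGroup`/`invariantLattice`/`actionModTorsion` of `KummerStructures.lean`):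

* `AbsTopMonoids.oxmuMap A f : O^{×μ}(G) ≃* O^{×μ}(H)` — the isomorphism induced by `O^⊳(f)` on `O^× ⧸ O^μ` (inline:
  `MulEquivModTorsion (Units.mapEquiv (A.mapOtri f))`; no new definition — an `abbrev`-free `theorem`-only file uses the
  term directly), `oxmuMap_mk`, and its EQUIVARIANCE `oxmuMap_actionModTorsion` (from `A.mapOtri_equivariant`);
* `AbsTopMonoids.map_invariantLattice_oxmuMap` — `O^⊳(f)` carries the lattice of `H' = f⁻¹(H'')` onto the lattice of
  `H''`;
* **`AbsTopMonoids.congr_mem_ism`** — conjugation by `O^⊳(f)` carries `Ism(G)` into `Ism(H)`: **the entire group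
  `Ism(−)` is "preserved by arbitrary isomorphisms `G₁ ⥲ G₂`"**, the first printed example of a `Γ^{×μ}`.

HONEST FRAMING: record-only under a disputed claim key; pure algebra over the interface; nothing here bears on
[IUTchIII] Cor. 3.12.
-/

set_option autoImplicit false

noncomputable section

namespace Literature.IUT.HodgeArakelov

open CategoryTheory

namespace AbsTopMonoids

universe u

variable {S : ThetaSetting.{u}} (A : AbsTopMonoids S) {G H : IsoClass S.Gk} (f : G ⟶ H)

/-- The isomorphism `O^{×μ}(G) ⥲ O^{×μ}(H)` induced by `O^⊳(f)` on the class of a unit.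
[claim: Mochizuki2012, status: disputed] (IUTchII §1 Ex 1.8 (iv), kurims p.38) -/
theorem oxmuMap_mk (u : A.Ounits G) :
    MulEquivModTorsion (Units.mapEquiv (A.mapOtri f)) (QuotientGroup.mk u) =
      (QuotientGroup.mk (Units.mapEquiv (A.mapOtri f) u) : A.Oxmu H) :=
  mulEquivModTorsion_mk _ u

/-- `O^⊳(f)` intertwines the unit actions: `O^×(f)(g · u) = f(g) · O^×(f)(u)` (`mapOtri_equivariant` on units).
[claim: Mochizuki2012, status: disputed] (IUTchII §1 Ex 1.8 (iii), kurims p.38) -/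
theorem mapEquiv_actOunits (g : G.G) (u : A.Ounits G) :
    Units.mapEquiv (A.mapOtri f) (A.actOunits G g u) = A.actOunits H (IsoClass.homIso f g) (Units.mapEquiv (A.mapOtri f) u) :=
  Units.ext (A.mapOtri_equivariant f g (u : A.Otri G))

/-- **EQUIVARIANCE of the induced isomorphism on `O^{×μ}`**: `O^{×μ}(f)(g · x) = f(g) · O^{×μ}(f)(x)`.
[claim: Mochizuki2012, status: disputed] (IUTchII §1 Ex 1.8 (iv), kurims p.38) -/
theorem oxmuMap_actionModTorsion (g : G.G) (x : A.Oxmu G) :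
    MulEquivModTorsion (Units.mapEquiv (A.mapOtri f)) (actionModTorsion (A.actOunits G) g x) =
      actionModTorsion (A.actOunits H) (IsoClass.homIso f g) (MulEquivModTorsion (Units.mapEquiv (A.mapOtri f)) x) := by
  induction x using QuotientGroup.induction_on with
  | H u => rw [actionModTorsion_mk, oxmuMap_mk, oxmuMap_mk, actionModTorsion_mk, mapEquiv_actOunits]

/-- … and its inverse: `O^{×μ}(f)⁻¹(f(g) · y) = g · O^{×μ}(f)⁻¹(y)`. [claim: Mochizuki2012, status: disputed] (IUTchII §1 Ex 1.8 (iv), kurims p.38) -/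
theorem oxmuMap_symm_actionModTorsion (g : G.G) (y : A.Oxmu H) :
    (MulEquivModTorsion (Units.mapEquiv (A.mapOtri f))).symm (actionModTorsion (A.actOunits H) (IsoClass.homIso f g) y) =
      actionModTorsion (A.actOunits G) g ((MulEquivModTorsion (Units.mapEquiv (A.mapOtri f))).symm y) := by
  apply (MulEquivModTorsion (Units.mapEquiv (A.mapOtri f))).injective
  rw [MulEquiv.apply_symm_apply, oxmuMap_actionModTorsion, MulEquiv.apply_symm_apply]

/-- A unit is fixed by `f⁻¹(H'')` iff its image under `O^×(f)` is fixed by `H''`.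
[claim: Mochizuki2012, status: disputed] (IUTchII §1 Ex 1.8 (iv), kurims p.39) -/
theorem mem_fixedBy_comap_iff (H'' : Subgroup H.G) (u : A.Ounits G) :
    u ∈ fixedBy (A.actOunits G) (H''.comap (IsoClass.homIso f).toMonoidHom) ↔
      Units.mapEquiv (A.mapOtri f) u ∈ fixedBy (A.actOunits H) H'' := by
  rw [mem_fixedBy, mem_fixedBy]
  constructor
  · intro hu h hh
    have hg : (IsoClass.homIso f).symm h ∈ H''.comap (IsoClass.homIso f).toMonoidHom := by
      change IsoClass.homIso f ((IsoClass.homIso f).symm h) ∈ H''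
      rwa [ContinuousMulEquiv.apply_symm_apply]
    have h1 := congrArg (Units.mapEquiv (A.mapOtri f)) (hu _ hg)
    rw [mapEquiv_actOunits, ContinuousMulEquiv.apply_symm_apply] at h1
    exact h1
  · intro hu g hg
    apply (Units.mapEquiv (A.mapOtri f)).injective
    rw [mapEquiv_actOunits]
    exact hu _ hg

/-- **`O^{×μ}(f)` carries lattices to lattices**: the image of the lattice of `f⁻¹(H'')` is the lattice of `H''`.
[claim: Mochizuki2012, status: disputed] (IUTchII §1 Ex 1.8 (iv), kurims p.39) -/
theorem map_invariantLattice_oxmuMap (H'' : Subgroup H.G) :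
    (invariantLattice (A.actOunits G) (H''.comap (IsoClass.homIso f).toMonoidHom)).map
        (MulEquivModTorsion (Units.mapEquiv (A.mapOtri f))).toMonoidHom =
      invariantLattice (A.actOunits H) H'' := by
  ext y
  constructor
  · rintro ⟨x, hx, rfl⟩
    obtain ⟨u, hu, rfl⟩ := Subgroup.mem_map.mp hx
    refine Subgroup.mem_map.mpr ⟨Units.mapEquiv (A.mapOtri f) u, (A.mem_fixedBy_comap_iff f H'' u).mp hu, ?_⟩
    exact (A.oxmuMap_mk f u).symm
  · intro hy
    obtain ⟨v, hv, rfl⟩ := Subgroup.mem_map.mp hy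
    refine ⟨QuotientGroup.mk ((Units.mapEquiv (A.mapOtri f)).symm v), Subgroup.mem_map.mpr
      ⟨(Units.mapEquiv (A.mapOtri f)).symm v, ?_, rfl⟩, ?_⟩
    · rw [A.mem_fixedBy_comap_iff f H'', MulEquiv.apply_symm_apply]
      exact hv
    · change MulEquivModTorsion (Units.mapEquiv (A.mapOtri f)) (QuotientGroup.mk _) = _
      rw [oxmuMap_mk, MulEquiv.apply_symm_apply]
      rfl

/-- **`Ism(−)` is preserved by arbitrary isomorphisms `G₁ ⥲ G₂`** ([IUTchII] Ex. 1.8 (iv) p. 39: the defining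
requirement on `Γ^{×μ}`, for the first printed example `Γ^{×μ} := Ism(−)`): conjugating a `G`-isometry of `O^{×μ}(G)`
by the isomorphism `O^{×μ}(f)` induced by `f : G ⥲ H` yields an `H`-isometry of `O^{×μ}(H)` — `G`-equivariance
transports along `O^⊳(f)`'s equivariance, and the lattice of an open `H'' ⊆ H` is the image of the lattice of the open
`f⁻¹(H'') ⊆ G`. [claim: Mochizuki2012, status: disputed] (IUTchII §1 Ex 1.8 (iv), kurims p.39) -/
theorem congr_mem_ism (γ : MulAut (A.Oxmu G)) (hγ : γ ∈ A.ism G) :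
    MulAut.congr (MulEquivModTorsion (Units.mapEquiv (A.mapOtri f))) γ ∈ A.ism H := by
  set e := MulEquivModTorsion (Units.mapEquiv (A.mapOtri f)) with he
  obtain ⟨hγ1, hγ2⟩ := (mem_isometryGroup _ _ _).mp hγ
  refine (mem_isometryGroup _ _ _).mpr ⟨fun h => ?_, fun H'' hH'' => ?_⟩
  · -- equivariance
    ext y
    change e (γ (e.symm (actionModTorsion (A.actOunits H) h y))) = actionModTorsion (A.actOunits H) h (e (γ (e.symm y)))
    have hh : IsoClass.homIso f ((IsoClass.homIso f).symm h) = h := ContinuousMulEquiv.apply_symm_apply _ h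
    conv_lhs => rw [← hh]
    rw [oxmuMap_symm_actionModTorsion]
    have h1 := congrArg (fun φ : MulAut (A.Oxmu G) => φ (e.symm y)) (hγ1 ((IsoClass.homIso f).symm h))
    simp only [MulAut.mul_apply] at h1
    rw [h1, oxmuMap_actionModTorsion, hh]
  · -- lattices: `H''` open in `H` ⇒ `f⁻¹(H'')` open in `G`
    have hH' : (H''.comap (IsoClass.homIso f).toMonoidHom) ∈ openSubgroups G :=
      (IsoClass.homIso f).continuous.isOpen_preimage _ hH''
    have hlat := A.map_invariantLattice_oxmuMap f H''
    rw [← hlat, Subgroup.map_map]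
    have hcomp : (MulAut.congr e γ).toMonoidHom.comp e.toMonoidHom = e.toMonoidHom.comp γ.toMonoidHom := by
      ext x
      change e (γ (e.symm (e x))) = e (γ x)
      rw [MulEquiv.symm_apply_apply]
    rw [hcomp, ← Subgroup.map_map, hγ2 _ hH']

end AbsTopMonoids

end Literature.IUT.HodgeArakelov

end
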